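import Summits.Ventures.LatticeQCDFlow.Scoring.U1TorusTopologicalChargeMoments
import HarnessLib

/-!
# Topological sectors of two-dimensional `U(1)` on the torus, IV: the topological susceptibility `χ_t = ⟨Q²⟩/V` as a definition

HONEST FRAMING: exact (Metropolis-corrected) sampling algorithms for lattice gauge theory;
figures of merit are autocorrelation/cost numbers at stated couplings and volumes; no
continuum-physics claim.

Venture `LatticeQCDFlow` (cell pub-lqcd), sub-topic `Scoring`; FANOUT row 5 (`s0-sun-a`), GEN-9.
NEW WORK of the cell (placement rule); part 4 of `Scoring/U1TorusTopologicalCharge*.lean`, the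
lead's NOT-TYPED item "`χ_t` beyond `⟨Q²⟩/V` as a definition".  The cell's oracle
(`ORACLE-u1-2d.json`, field `Q2`; `chi_t = Q2 / V`) and the STEP-0 sealed cards quote the
topological susceptibility of 2-d compact `U(1)` on the `L × L` torus as `χ_t = ⟨Q²⟩/V`, `V = L²`,
`Q` the geometric topological charge.  Here it becomes a named real number of theory-2's lattice
measure:

* `u1TopSusceptibility L β := (∫ Q² dμ_{Λ,β}) / L²` (`μ_{Λ,β} = wilsonMeasure u1Rep β` on
  `GaugeConfig 2 L Circle`, `Q = Theory2.Lattice.topCharge`);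
* `u1TopSusceptibility_eq_sum` — `χ_t = (Σ_{|k| ≤ L²} k²·P(Q = k)) / L²` (GEN-8's
  `integral_topCharge_sq`), and `u1TopSusceptibility_eq_sum_sectorWeight` — the closed form
  `χ_t = (Σ_k k²·g_V(2πk)) / (L²·Σ_j g_V(2πj))` through the topological-charge law (`L ≥ 2`);
* `u1TopSusceptibility_nonneg`, `u1TopSusceptibility_le` — `0 ≤ χ_t ≤ L²/4` (`|Q| ≤ L²/2`);
* `mul_u1TopSusceptibility_eq_variance` — `L²·χ_t = Var(Q)` (`⟨Q⟩ = 0`, GEN-8's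
  `integral_topCharge`; Mathlib's `ProbabilityTheory.variance`), `L ≥ 2`.

One definition (`u1TopSusceptibility`); everything else proved; nothing cited.  NOT here: the
infinite-volume limit `χ_t(β) = lim_{L→∞}` (exists and equals the second moment ratio of the
one-plaquette weight — not typed), enclosures of its numerical values.
-/

noncomputable section

open MeasureTheory Set Real Finset ProbabilityTheory
open scoped ENNReal
open Literature.MathematicalPhysics.QuantumFieldTheory
open Literature.MathematicalPhysics.QuantumLattice (u1Rep u1Rep_apply continuous_u1Rep)
open Summit.Ventures.LatticeQCDFlow.Theory2.Lattice (topCharge exists_int_eq_topCharge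
  measurable_topCharge)

namespace Summit.Ventures.LatticeQCDFlow.Scoring

variable {L : ℕ} [NeZero L]

/-- **The topological susceptibility of two-dimensional compact `U(1)` on the `L × L` torus**:
`χ_t(L, β) = ⟨Q²⟩_{Λ,β} / L²`, the second moment of theory-2's geometric topological charge
`Q = (2π)⁻¹ Σ_x arg U_x` under the Wilson measure `wilsonMeasure u1Rep β`, per plaquette
(`V = L²` plaquettes).  Since `⟨Q⟩ = 0` this is the variance of `Q` per unit volume
(`mul_u1TopSusceptibility_eq_variance`); it is the oracle's `chi_t = Q2 / V`. -/
def u1TopSusceptibility (L : ℕ) [NeZero L] (β : ℝ) : ℝ :=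
  (∫ U, (topCharge U) ^ 2 ∂(wilsonMeasure (d := 2) (L := L) u1Rep β)) / (L : ℝ) ^ 2

variable (β : ℝ)

/-- **`χ_t` as a finite sum over the sectors**: `χ_t = (Σ_{|k| ≤ L²} k²·P(Q = k)) / L²`. -/
theorem u1TopSusceptibility_eq_sum :
    u1TopSusceptibility L β =
      (∑ k ∈ Finset.Icc (-(L ^ 2 : ℤ)) (L ^ 2 : ℤ),
        (k : ℝ) ^ 2 * (wilsonMeasure (d := 2) (L := L) u1Rep β {U | topCharge U = k}).toReal) /
        (L : ℝ) ^ 2 := by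
  rw [u1TopSusceptibility, integral_topCharge_sq]

/-- **`χ_t` in closed form**: `χ_t = (Σ_{|k| ≤ L²} k²·g_V(2πk)) / (L²·Σ_{j ∈ ℤ} g_V(2πj))`, `V = L²`,
`g_V` the `V`-fold convolution power of the one-plaquette weight (`u1SectorWeight`), for every
`L ≥ 2` and every real `β` — the topological-charge law `P(Q = k) = g_V(2πk)/Σ_j g_V(2πj)`. -/
theorem u1TopSusceptibility_eq_sum_sectorWeight (hL : 2 ≤ L) :
    u1TopSusceptibility L β =
      (∑ k ∈ Finset.Icc (-(L ^ 2 : ℤ)) (L ^ 2 : ℤ), (k : ℝ) ^ 2 * (u1SectorWeight β (L ^ 2) k).toReal) /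
        ((L : ℝ) ^ 2 * (∑' j : ℤ, u1SectorWeight β (L ^ 2) j).toReal) := by
  rw [u1TopSusceptibility_eq_sum]
  simp_rw [wilsonMeasure_topCharge_toReal β hL, mul_div_assoc']
  rw [← Finset.sum_div, div_div]
  congr 1
  exact mul_comm _ _

/-- `χ_t ≥ 0`. -/
theorem u1TopSusceptibility_nonneg : 0 ≤ u1TopSusceptibility L β :=
  div_nonneg (integral_nonneg fun _ => sq_nonneg _) (sq_nonneg _)

/-- **`χ_t ≤ L²/4`**: `Q² ≤ L⁴/4` pointwise (`|Q| ≤ L²/2`, `abs_topCharge_le`). -/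
theorem u1TopSusceptibility_le : u1TopSusceptibility L β ≤ (L : ℝ) ^ 2 / 4 := by
  have hL0 : (0 : ℝ) < (L : ℝ) ^ 2 := by
    have : (0 : ℝ) < L := by exact_mod_cast Nat.pos_of_ne_zero (NeZero.ne L)
    positivity
  rw [u1TopSusceptibility, div_le_iff₀ hL0]
  have hpt : ∀ U : GaugeConfig 2 L Circle, (topCharge U) ^ 2 ≤ ((L : ℝ) ^ 2 / 2) ^ 2 := fun U => by
    have h := abs_topCharge_le U
    have h0 : 0 ≤ |topCharge U| := abs_nonneg _
    calc (topCharge U) ^ 2 = |topCharge U| ^ 2 := (sq_abs _).symm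
      _ ≤ ((L : ℝ) ^ 2 / 2) ^ 2 := pow_le_pow_left₀ h0 h 2
  calc ∫ U, (topCharge U) ^ 2 ∂(wilsonMeasure (d := 2) (L := L) u1Rep β)
      ≤ ∫ _U, ((L : ℝ) ^ 2 / 2) ^ 2 ∂(wilsonMeasure (d := 2) (L := L) u1Rep β) :=
        integral_mono_of_nonneg (Filter.Eventually.of_forall fun U => sq_nonneg _)
          (integrable_const _) (Filter.Eventually.of_forall hpt)
    _ = ((L : ℝ) ^ 2 / 2) ^ 2 := by simp
    _ = (L : ℝ) ^ 2 / 4 * (L : ℝ) ^ 2 := by ring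

/-- `Q` is square integrable under the Wilson measure (it is bounded and measurable). -/
theorem memLp_topCharge : MemLp (topCharge (L := L)) 2 (wilsonMeasure (d := 2) (L := L) u1Rep β) :=
  memLp_of_bounded (a := -((L : ℝ) ^ 2 / 2)) (b := (L : ℝ) ^ 2 / 2)
    (Filter.Eventually.of_forall fun U => abs_le.mp (abs_topCharge_le U))
    measurable_topCharge.aestronglyMeasurable 2

/-- **`L²·χ_t = Var(Q)`** (`L ≥ 2`): since `⟨Q⟩ = 0`, the susceptibility is the variance of the
topological charge per plaquette. -/
theorem mul_u1TopSusceptibility_eq_variance (hL : 2 ≤ L) :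
    (L : ℝ) ^ 2 * u1TopSusceptibility L β =
      variance (topCharge (L := L)) (wilsonMeasure (d := 2) (L := L) u1Rep β) := by
  have hL0 : (L : ℝ) ^ 2 ≠ 0 := by
    have : (0 : ℝ) < L := by exact_mod_cast Nat.pos_of_ne_zero (NeZero.ne L)
    positivity
  rw [u1TopSusceptibility, mul_div_cancel₀ _ hL0,
    variance_of_integral_eq_zero measurable_topCharge.aemeasurable (integral_topCharge β hL)]

end Summit.Ventures.LatticeQCDFlow.Scoring
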